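import Summits.ResolutionOfSingularities.ResolutionOfSingularities.Theorems.PAlterationPialtSqueezeRRLU1
import Literature.AlgebraicGeometry.Resolution.LocalUniformizationClosedPoints
import HarnessLib

/-!
# `PalterationThesis` (crux stmt-ResolutionOfSingularities-0552), line `Sketch` rev. c4:
# glue stub `stub_rrLU1_of_zeroDim` — RRLU1 over `K` needs only zero-dimensional valuation rings

Glue stub `stub_rrLU1_of_zeroDim` of the skeleton `Sketch` (rev. c4) for crux
stmt-ResolutionOfSingularities-0552 (`--supports`, it does not close the item): Zariski's
closed-point reduction for the atom RRLU1 over a field `K`.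

**Statement.** Fix `p : ℕ` and a field `K`. Suppose that for all height-one Frobenius sandwich
data — fields `K ⊆ F ⊆ L` with `F/K` finitely generated, `L/F` purely inseparable generated by
one `y` with `y ^ p ∈ F`, a finitely generated REGULAR `K`-subalgebra `B ⊆ L` with `Frac B = L` —
every valuation ring `O ⊇ B` of `L` that is ZERO-DIMENSIONAL over `K` (every `x ∈ O` is a root
modulo `𝔪_O` of a non-zero polynomial over `K`, and likewise for the trace `O ∩ F`) has its trace
`O ∩ F = O.comap (algebraMap F L)` locally uniformizable over `K`. Then the same holds for EVERY
valuation ring `O ⊇ B` of `L`.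

**Proof.** Refine `O` to a valuation ring `O₁ ⊇ B` of `L` minimal among those containing `B`
(`exists_minimal_valuationSubring_le`); it is zero-dimensional over `K`
(`exists_aeval_mem_nonunits_of_minimal`, `B` being finitely generated), and so is its trace
`O₁ ∩ F` (non-units are reflected along the injective `algebraMap F L`, and
`algebraMap F L (aeval x f) = aeval (algebraMap F L x) f`). The hypothesis uniformizes `O₁ ∩ F`
by some `A`; as `O₁ ∩ F ≤ O ∩ F`, the same `A` is regular at the centre of `O ∩ F`
(`isRegularLocalRing_centre_of_le`).

Source: O. Zariski, P. Samuel, *Commutative Algebra* II (1960), Ch. VI §17 (closed points of the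
Zariski–Riemann space); folklore.
-/

set_option linter.dupNamespace false -- mandated namespace of this single-conjunct summit

noncomputable section

open IsLocalRing Literature.AlgebraicGeometry.Resolution

namespace Summit.ResolutionOfSingularities.ResolutionOfSingularities.Theorems.PalterationThesis.PerfectAtoms

/-- Non-units of a valuation ring are preserved and reflected by the trace along a ring map of
fields: `x ∈ (O.comap φ).nonunits ↔ φ x ∈ O.nonunits`. [folklore] -/
private theorem mem_nonunits_comap_iff_of_field {F L : Type} [Field F] [Field L] (φ : F →+* L)
    (O : ValuationSubring L) (x : F) : x ∈ (O.comap φ).nonunits ↔ φ x ∈ O.nonunits := by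
  rw [ValuationSubring.mem_nonunits_iff_or, ValuationSubring.mem_nonunits_iff_or,
    ValuationSubring.mem_comap, map_inv₀, map_eq_zero_iff φ φ.injective]

/-- Zero-dimensionality over `K` of a valuation ring `O` of `L` passes to its trace
`O.comap (algebraMap F L)` on an intermediate field `K ⊆ F ⊆ L`. [folklore] -/
private theorem zeroDim_comap {K F L : Type} [Field K] [Field F] [Field L] [Algebra K F]
    [Algebra F L] [Algebra K L] [IsScalarTower K F L] (O : ValuationSubring L)
    (h0 : ∀ x ∈ O, ∃ f : Polynomial K, f ≠ 0 ∧ Polynomial.aeval x f ∈ O.nonunits) :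
    ∀ x ∈ O.comap (algebraMap F L), ∃ f : Polynomial K, f ≠ 0 ∧
      Polynomial.aeval x f ∈ (O.comap (algebraMap F L)).nonunits := by
  intro x hx
  obtain ⟨f, hf0, hf⟩ := h0 (algebraMap F L x) (ValuationSubring.mem_comap.mp hx)
  refine ⟨f, hf0, (mem_nonunits_comap_iff_of_field (algebraMap F L) O _).mpr ?_⟩
  rwa [Polynomial.aeval_algebraMap_apply] at hf

/-- **RRLU1 over `K` needs only zero-dimensional valuation rings** (glue stub
`stub_rrLU1_of_zeroDim` of line `Sketch` rev. c4, crux stmt-0552; Zariski's closed-point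
reduction). If, for all height-one Frobenius sandwich data `K ⊆ F ⊆ L ⊇ B` over the field `K`
(`F/K` finitely generated, `L = F(y)` purely inseparable with `y ^ p ∈ F`, `B ⊆ L` a finitely
generated regular `K`-subalgebra with `Frac B = L`), every valuation ring `O ⊇ B` of `L` whose
residue field is algebraic over `K` (on `L`, and for its trace on `F`) has `O ∩ F` locally
uniformizable over `K`, then so does EVERY valuation ring `O ⊇ B`: refine `O` to a valuation
ring `O₁ ⊇ B` minimal with this property (`exists_minimal_valuationSubring_le`), which is
zero-dimensional (`exists_aeval_mem_nonunits_of_minimal`) together with its trace on `F`,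
uniformize `O₁ ∩ F`, and coarsen (`isRegularLocalRing_centre_of_le`, `O₁ ∩ F ≤ O ∩ F`).
[cite: ZariskiSamuel1960, Ch. VI §17] -/
theorem stub_rrLU1_of_zeroDim (p : ℕ) (K : Type) [Field K] :
    (∀ (F L : Type) [Field F] [Field L] [Algebra K F] [Algebra F L] [Algebra K L]
      [IsScalarTower K F L], (⊤ : IntermediateField K F).FG → IsPurelyInseparable F L →
      (∃ y : L, y ^ p ∈ (algebraMap F L).range ∧ IntermediateField.adjoin F {y} = ⊤) →
      ∀ B : Subalgebra K L, B.FG → IsFractionRing B L → IsRegularRing B →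
      ∀ O : ValuationSubring L, B.toSubring ≤ O.toSubring →
        (∀ x ∈ O, ∃ f : Polynomial K, f ≠ 0 ∧ Polynomial.aeval x f ∈ O.nonunits) →
        (∀ x ∈ O.comap (algebraMap F L), ∃ f : Polynomial K, f ≠ 0 ∧
          Polynomial.aeval x f ∈ (O.comap (algebraMap F L)).nonunits) →
        IsLocallyUniformizable K F (O.comap (algebraMap F L))) →
    ∀ (F L : Type) [Field F] [Field L] [Algebra K F] [Algebra F L] [Algebra K L]
      [IsScalarTower K F L], (⊤ : IntermediateField K F).FG → IsPurelyInseparable F L →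
      (∃ y : L, y ^ p ∈ (algebraMap F L).range ∧ IntermediateField.adjoin F {y} = ⊤) →
      ∀ B : Subalgebra K L, B.FG → IsFractionRing B L → IsRegularRing B →
      ∀ O : ValuationSubring L, B.toSubring ≤ O.toSubring →
        IsLocallyUniformizable K F (O.comap (algebraMap F L)) := by
  intro h F L _ _ _ _ _ _ hfg hpi hy B hBfg hBfr hBreg O hBO
  obtain ⟨O₁, hO₁O, hBO₁, hmin⟩ := exists_minimal_valuationSubring_le B O hBO
  have h0L : ∀ x ∈ O₁, ∃ f : Polynomial K, f ≠ 0 ∧ Polynomial.aeval x f ∈ O₁.nonunits :=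
    exists_aeval_mem_nonunits_of_minimal B hBfg O₁ hBO₁ hmin
  obtain ⟨A, hA, hAfg, hfr, hreg⟩ :=
    h F L hfg hpi hy B hBfg hBfr hBreg O₁ hBO₁ h0L (zeroDim_comap O₁ h0L)
  have hle : O₁.comap (algebraMap F L) ≤ O.comap (algebraMap F L) := fun x hx =>
    ValuationSubring.mem_comap.mpr (hO₁O (ValuationSubring.mem_comap.mp hx))
  exact ⟨A, fun x hx => hle (hA hx), hAfg, hfr, isRegularLocalRing_centre_of_le A hle hA _ hreg⟩

end Summit.ResolutionOfSingularities.ResolutionOfSingularities.Theorems.PalterationThesis.PerfectAtoms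

end
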